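import Summits.BirchSwinnertonDyer.BirchSwinnertonDyer.Theorems.BiquadraticEisensteinDescentEisensteinHeartFlatCMInertBadKPrimeThetaRoute
import HarnessLib

set_option linter.dupNamespace false -- `Summit.BirchSwinnertonDyer.BirchSwinnertonDyer.Theorems.…` (summit = sub, D-0017)
set_option autoImplicit false

/-!
# Crux `EisensteinHeartFlatCMInertBadKPrime` (stmt-BirchSwinnertonDyer-21341), line `hsieh-lambda`, layer 2:
# the V2 socket's remaining ϑ-binders `hIm` and `hS` at the frame

Route `BiquadraticEisensteinDescent` (width seat `bsd-wall-cm-bed-w2` g7; sequel of `…ThetaRoute.lean` (p623873)).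
THEOREMS ONLY (no definition, no named fact, no `sorry`). BSD is not proved by any of this.

The V2 socket `…KatzHsiehSocket.exists_isBaseChangeLine_span_C_mul_eq` (w3 g5) has, beyond the Katz fact's ϑ/D/T binders
delivered by `…ThetaRoute.exists_theta_datum_route`, two more binders this side can discharge:

* `hIm : ∀ w, (KatzCM.embeddingAt ι Sp w ϑ).im ≠ 0` — **`im_apply_ne_zero_of_re_eq_zero`**: (d1) for all `σ` and
  `Im σ₀(ϑ) > 0` for ONE `σ₀` (so `ϑ ≠ 0`) ⟹ `Im σ(ϑ) ≠ 0` for EVERY `σ : L →+* ℂ` (in particular every `embeddingAt`);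
  a `σ₀` with `σ₀|_{K′} = φ̄₀` always exists (`NumberField.ComplexEmbedding.lift`), so the comp-form Σ-positivity of
  `…Theta.exists_theta` suffices — **`exists_theta_datum_route_im`** = the route datum with the ELEVENTH conclusion
  `∀ σ, (σ ϑ).im ≠ 0`.
* `hS : ∀ w ∈ S, p ∉ w` for `S` = primes above the bad `ℓ ≠ p` — **`natCast_not_mem_of_natCast_mem_of_ne`**: a prime of
  `𝓞 L` contains at most one rational prime.
[cite: Hsieh2014mu, §3.1 (d1), §4.8]
-/

noncomputable section

open scoped nonZeroDivisors NumberField Pointwise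

namespace Summit.BirchSwinnertonDyer.BirchSwinnertonDyer.Theorems.BiquadraticEisensteinDescentEisensteinHeartFlatCMInertBadKPrimeThetaRouteIm

open NumberField IsDedekindDomain WeierstrassCurve Literature.NumberTheory.EllipticCurves
  Literature.NumberTheory.EllipticCurves.Rank1Residual Literature.NumberTheory.Automorphic
open Summit.BirchSwinnertonDyer.BirchSwinnertonDyer.Theorems.BiquadraticEisensteinDescentEisensteinHeartFlatCMInertBadKPrimeTheta
open Summit.BirchSwinnertonDyer.BirchSwinnertonDyer.Theorems.BiquadraticEisensteinDescentEisensteinHeartFlatCMInertBadKPrimeGenus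
open Summit.BirchSwinnertonDyer.BirchSwinnertonDyer.Theorems.BiquadraticEisensteinDescentEisensteinHeartFlatCMInertBadKPrimeThetaDatum
open Summit.BirchSwinnertonDyer.BirchSwinnertonDyer.Theorems.BiquadraticEisensteinDescentEisensteinHeartFlatCMInertBadKPrimeThetaRoute

/-! ## §1 Two small lemmas -/

section Lemmas

variable {L : Type} [Field L]

/-- **`Im σ(ϑ) ≠ 0` for every embedding** once `Re σ(ϑ) = 0` for every `σ` and `ϑ ≠ 0`. [cite: Hsieh2014mu, §3.1 (d1)] -/
theorem im_apply_ne_zero_of_re_eq_zero {ϑ : L} (hre : ∀ σ : L →+* ℂ, (σ ϑ).re = 0) (hϑ : ϑ ≠ 0)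
    (σ : L →+* ℂ) : (σ ϑ).im ≠ 0 := by
  intro him
  have h0 : σ ϑ = 0 := Complex.ext (by simpa using hre σ) (by simpa using him)
  exact hϑ (by simpa using (map_eq_zero_iff σ σ.injective).mp h0)

/-- **A prime of `𝓞 L` contains at most one rational prime**: `ℓ ∈ w`, `ℓ ≠ p` primes ⟹ `p ∉ w`.
[cite: NeukirchANT1999, Ch. I §8] -/
theorem natCast_not_mem_of_natCast_mem_of_ne [NumberField L] {ℓ p : ℕ} (hℓ : ℓ.Prime) (hp : p.Prime)
    (hne : ℓ ≠ p) (w : HeightOneSpectrum (𝓞 L)) (hw : ((ℓ : ℕ) : 𝓞 L) ∈ w.asIdeal) :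
    ((p : ℕ) : 𝓞 L) ∉ w.asIdeal := by
  intro hpw
  have hcop : Nat.Coprime ℓ p := (Nat.coprime_primes hℓ hp).mpr hne
  obtain ⟨a, b, hab⟩ := Nat.isCoprime_iff_coprime.mpr hcop
  have h1 : (1 : 𝓞 L) ∈ w.asIdeal := by
    have : ((a * ℓ + b * p : ℤ) : 𝓞 L) ∈ w.asIdeal := by
      push_cast
      exact w.asIdeal.add_mem (w.asIdeal.mul_mem_left _ (by exact_mod_cast hw))
        (w.asIdeal.mul_mem_left _ (by exact_mod_cast hpw))
    rwa [hab, Int.cast_one] at this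
  exact w.isPrime.ne_top ((Ideal.eq_top_iff_one _).mpr h1)

end Lemmas

/-! ## §2 The route datum with `hIm` -/

/-- **The ϑ/D/T-datum of the Katz fact from the item's binders, with the socket's `hIm`**: the eleven conclusions
`hϑ₁ hϑ₂ hIm' hTS hT hST hD₁ hD₂ hD₃ hD₄ hd2` (`hIm'`: `∀ σ, (σ ϑ).im ≠ 0`, giving `hIm` at every `embeddingAt ι Sp w`).
[cite: Hsieh2014mu, §3.1 (d1) (d2), §4.8] -/
theorem exists_theta_datum_route_im (W : WeierstrassCurve ℚ) [W.IsElliptic] [W.IsGloballyMinimal]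
    [NeZero (W.conductorNorm ℤ)] (p : ℕ) [Fact p.Prime] (K : Type) [Field K] [NumberField K]
    (hCM : W.HasCM) (hbad : ¬ Good W p) (hK : IsImaginaryQuadratic K)
    (hHN : SatisfiesHeegnerHypothesis (W.conductorNorm ℤ) K)
    (L : Type) [Field L] [NumberField L] [Algebra K L] [IsCMField L] (h2 : Module.finrank K L ≤ 2)
    {x : L} (hgen : Algebra.adjoin K {x} = ⊤) (hx : x ^ 2 = (cmFieldDiscrOfJ W.j : L))
    (φ₀ : K →+* ℂ) {ι : PadicAlgCl p ≃+* ℂ} {Sp : Finset (HeightOneSpectrum (𝓞 L))}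
    (hSigma : ∀ σ : L →+* ℂ, KatzCM.InSigma ι Sp σ →
      σ.comp (algebraMap K L) = NumberField.ComplexEmbedding.conjugate φ₀)
    (S : Finset (HeightOneSpectrum (𝓞 L)))
    (hSP : ∀ w ∈ S, ∃ ℓ ∈ (W.conductorNorm ℤ).primeFactors, ((ℓ : ℕ) : 𝓞 L) ∈ w.asIdeal) :
    ∃ (ϑ : L) (D T : Finset (HeightOneSpectrum (𝓞 L))),
      (∀ σ : L →+* ℂ, (σ ϑ).re = 0) ∧
      (∀ σ : L →+* ℂ, KatzCM.InSigma ι Sp σ → 0 < (σ ϑ).im) ∧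
      (∀ σ : L →+* ℂ, (σ ϑ).im ≠ 0) ∧
      T ⊆ S ∧ (∀ w ∈ T, IsCMField.complexConj L • w ≠ w ∧ IsCMField.complexConj L • w ∉ T) ∧
      (∀ w ∈ S, IsCMField.complexConj L • w ≠ w → (w ∈ T ∨ IsCMField.complexConj L • w ∈ T)) ∧
      KatzCM.primesOver L p ⊆ D ∧ S ⊆ D ∧
      (∀ w ∈ S, IsCMField.complexConj L • w ∈ D) ∧
      (∀ w : HeightOneSpectrum (𝓞 L), w.asIdeal.ramificationIdx (𝓞 (maximalRealSubfield L)) ≠ 1 → w ∈ D) ∧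
      (∀ w ∈ D, ordAt w (2 * ϑ) = differentExponentAt w) := by
  classical
  -- the frame's arithmetic (as in `exists_theta_datum_route`)
  obtain ⟨y, hy, hφ₀⟩ := exists_sq_eq_discr_im_neg hK φ₀
  have hN0 : W.conductorNorm ℤ ≠ 0 := NeZero.ne _
  have hpN : p ∣ W.conductorNorm ℤ := (W.dvd_conductorNorm_iff_not_hasGoodReductionAtPrime p).mpr hbad
  set P := (W.conductorNorm ℤ).primeFactors with hPdef
  have hP : ∀ ℓ ∈ P, ℓ.Prime := fun ℓ hℓ ↦ Nat.prime_of_mem_primeFactors hℓ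
  have hPK : ∀ ℓ ∈ P, ¬ (ℓ : ℤ) ∣ NumberField.discr K := fun ℓ hℓ ↦
    not_dvd_discr_of_heegner hK hHN (Nat.prime_of_mem_primeFactors hℓ) (Nat.dvd_of_mem_primeFactors hℓ)
  have hpP : p ∈ P := Nat.mem_primeFactors.mpr ⟨Fact.out, hpN, hN0⟩
  have hd := cmFieldDiscrOfJ_mem_nine W hCM
  have hcop : ∀ ℓ : ℕ, ℓ.Prime → (ℓ : ℤ) ∣ cmFieldDiscrOfJ W.j → ¬ (ℓ : ℤ) ∣ NumberField.discr K :=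
    fun ℓ hℓ hℓd ↦ not_dvd_discr_of_dvd_cmFieldDiscr W hCM hK hHN hℓ hℓd
  -- ϑ in the comp form, then the sets D, T exactly as in `exists_theta_datum`
  obtain ⟨ϑ, hd1, hpos, hd2⟩ := exists_theta_of_mem L h2 hgen hx hd hy hK.discr_neg hφ₀ P hP hPK
  -- `ϑ ≠ 0`: an embedding extending `φ̄₀` exists and sees `Im > 0`
  have hϑ0 : ϑ ≠ 0 := by
    intro h0
    have hσ := hpos (NumberField.ComplexEmbedding.lift L (NumberField.ComplexEmbedding.conjugate φ₀))
      (NumberField.ComplexEmbedding.lift_comp_algebraMap L _)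
    rw [h0, map_zero, Complex.zero_im] at hσ
    exact lt_irrefl _ hσ
  obtain ⟨T, hTS, hT, hST⟩ := exists_transversal (fun w ↦ IsCMField.complexConj L • w)
    (fun w ↦ by
      have hc2 : IsCMField.complexConj L ^ 2 = 1 := by
        rw [← IsCMField.orderOf_complexConj L]; exact pow_orderOf_eq_one _
      change IsCMField.complexConj L • (IsCMField.complexConj L • w) = w
      rw [smul_smul, ← pow_two, hc2, one_smul]) S
  have hNP0 : ((∏ ℓ ∈ P, ℓ : ℕ) : 𝓞 L) ≠ 0 := by
    exact_mod_cast (Finset.prod_pos fun ℓ hℓ ↦ (hP ℓ hℓ).pos).ne'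
  have hfin : ({v : HeightOneSpectrum (𝓞 L) | v.asIdeal ∣ Ideal.span {((∏ ℓ ∈ P, ℓ : ℕ) : 𝓞 L)}}).Finite :=
    Ideal.finite_factors (by rwa [Ne, Ideal.zero_eq_bot, Ideal.span_singleton_eq_bot])
  refine ⟨ϑ, hfin.toFinset, T, hd1, fun σ hσ ↦ hpos σ (hSigma σ hσ), im_apply_ne_zero_of_re_eq_zero hd1 hϑ0,
    hTS, hT, hST, ?_, ?_, ?_, ?_, ?_⟩
  · intro w hw
    rw [KatzCM.mem_primesOver] at hw
    exact (mem_primesAbove_iff P w hfin).mpr ⟨p, hpP, hw⟩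
  · intro w hw
    exact (mem_primesAbove_iff P w hfin).mpr (hSP w hw)
  · intro w hw
    obtain ⟨ℓ, hℓP, hℓw⟩ := hSP w hw
    refine (mem_primesAbove_iff P _ hfin).mpr ⟨ℓ, hℓP, ?_⟩
    rw [HeightOneSpectrum.smul_asIdeal, Ideal.mem_pointwise_smul_iff_inv_smul_mem,
      Literature.NumberTheory.GaloisRepresentations.HeckeCharacter.complexConj_smul_natCast]
    exact hℓw
  · exact hD4_of_frame_of_mem hK.1 h2 hgen hx hd hy hK.discr_neg hcop hfin.toFinset
  · intro w hw
    obtain ⟨ℓ, hℓP, hℓw⟩ := (mem_primesAbove_iff P w hfin).mp hw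
    exact hd2 w ℓ hℓP hℓw

end Summit.BirchSwinnertonDyer.BirchSwinnertonDyer.Theorems.BiquadraticEisensteinDescentEisensteinHeartFlatCMInertBadKPrimeThetaRouteIm

end
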